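import Literature.NumberTheory.LFunctions.Zhang2022.MainTermFormEllPairs
import Literature.NumberTheory.LFunctions.Zhang2022.MainTermFormCauchySchwarz
import Literature.NumberTheory.LFunctions.Zhang2022.MainTermFormH1
import HarnessLib

/-!
# Zhang (2022): the `K₀` directions are NULL directions of the main-term form `𝔅` — perturbing a
# `K₀` vector costs exactly second order (cell `landau-siegel`, family B-ell; ls-ref-1's «kernel lemma»
# for the D-ELL-1-K0 calibration table, PROVED)

Topic `Literature/NumberTheory/LFunctions/Zhang2022` (Landau–Siegel audit tree; verdict-neutral).
Y. Zhang, arXiv:2211.02515v1 (2022) [Zhang2022LandauSiegel] is an unrefereed manuscript under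
adjudication; NOTHING here asserts or denies its Theorems 1–2 and nothing here is a claim about
Landau–Siegel zeros.  Theorems only (no `def`, no new statement of the manuscript): elementary linear
algebra of the tree's PSD main-term form `mainTermForm = 𝔅` (`MainTermFormPSD`, (2.32)/Prop. 7.1 main term)
and its polar form `mainTermFormPolar` (`MainTermFormCauchySchwarz`), applied to the three `K₀` profiles
`k₁ − k₃`, `k₁ + k₂`, `k₂ + k₃` of the cell's B-ell designs (`twoComb`, `MainTermFormEllPairs`;
B-ell/designs/ell-K0-pos.json).

WHY.  The cell's referee ls-ref-1 (INBOX 2026-08-26T19:26:38Z (2), folded in B-ell/EDLIST.md v1.9 row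
ell-E4′∣K₀ as a DESK statement) audits the first-order table D-ELL-1-K0 with the «KERNEL LEMMA»: `F₁ = 𝔅 ⪰ 0`
and `𝔅(u) = 0` on `K₀` ⇒ `u` is a global minimiser ⇒ every perturbation OF THE VECTOR `u` changes `𝔅` only
at SECOND order, so at order `1/A` only FORM-side perturbations (the `ℓ`-slope, shift-detuned weights, the
`ℓ′`-phase, the dipole weights) can contribute.  This file makes that lemma a kernel theorem, EXACTLY (not
just to first order):

* `mainTermFormPolar_eq_zero_of_null` — for `H¹` profiles, `𝔅(u) = 0 ⇒ P(u,f) = 0` for every `H¹` profile `f`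
  (Cauchy–Schwarz `‖P(u,f)‖² ≤ 𝔅(u)𝔅(f)`, `norm_sq_mainTermFormPolar_le`);
* `mainTermForm_null_add_smul` — `𝔅(u + t·f) = ‖t‖²·𝔅(f)`: moving a null vector by `t·f` costs exactly
  `‖t‖²𝔅(f)` (second order in `t`, no linear term);
* `mainTermForm_add_smul_null` — `𝔅(f + t·u) = 𝔅(f)`: null directions are invisible to `𝔅`;
* the `K₀` instances: `mainTermForm_k13/_k12/_k23` (`𝔅 = F₁` vanishes on `k₁ − k₃`, `k₁ + k₂`, `k₂ + k₃` —
  from `mainTermFormEll_k13/_k12/_k23` at `ℓ = 1`), `mainTermFormPolar_k13/_k12/_k23` (`P(u, f) = 0`),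
  `mainTermForm_k13_add_smul` etc. (`𝔅(u + t f) = ‖t‖²𝔅(f)`), `mainTermForm_add_smul_k13` etc.
  (`𝔅(f + t u) = 𝔅(f)`).

§2 (v2) **The `K₀` cubics BELOW `ℓ = 1`, exact and strictly positive** (REF-B2 countersignature of the B-ell
block-B `K₀` words, cell STATUS 2026-08-26T20:07:03Z «F_{1−η}/π = 32η−16η²+64η³ / 8η−40η²+72η³ / 8η+56η²+40η³
> 0 for ALL η > 0»): `mainTermFormEll_k13_one_sub` / `_k12_one_sub` / `_k23_one_sub` (the substitution
`ℓ = 1 − η` in ls-Bell-typer-2 g0's cubics `mainTermFormEll_k13/_k12/_k23`) and `mainTermFormEll_k13_pos_of_lt_one`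
/ `_k12_pos_of_lt_one` / `_k23_pos_of_lt_one`: `F_ℓ > 0` on each `K₀` profile for EVERY `ℓ < 1` (negative
discriminants `16² − 4·64·32 < 0`, `40² − 4·72·8 < 0`; all coefficients positive for `k₂ + k₃`).  In the frame of
record the effective parameter on a full-length one-piece profile is `ℓ·r = log P/L_Δ(P) < 1` (ls-obj-eng-3,
`ObjectiveTwinEllFrame.lean`: `F_ℓ(rescale r G) = r⁻¹F_{ℓr}(G)`, `IsEllRegimeP.frame_bounds`), so these are the
exact main-order values behind «K₀-POS: no at main order» — companions of the abstract `mainTerm_frame_nonneg`.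

Deliberately NOT here: the rescaled/physical frame itself (ls-obj-eng-3's scaling law), the shift-detuning
derivative `D_bF` (form-side, non-zero on `K₀` — the point of the lemma), any number of the calibration table.

## References
* Y. Zhang, arXiv:2211.02515v1 (2022), §2 (2.13), (2.23)–(2.25), (2.32); §7 Prop. 7.1 (the main-term form).
  [Zhang2022LandauSiegel]

«The programme SEARCHES and TYPES; no claim about Landau–Siegel zeros, Theorems 1–2 of arXiv:2211.02515 or
a repaired Margin232 until a kernel theorem says so.»
-/

noncomputable section

open Complex Real ComplexConjugate

namespace Literature.NumberTheory.LFunctions.Zhang2022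

variable {u u' f f' : ℝ → ℂ}

/-! ## Null vectors of the PSD form `𝔅` -/

/-- **A null vector of `𝔅` annihilates the polar form**: for `H¹` profiles `u, f` with `𝔅(u) = 0`,
`P(u,f) = 0` (Cauchy–Schwarz `‖P(u,f)‖² ≤ 𝔅(u)·𝔅(f) = 0`).  [cite: Zhang2022LandauSiegel, §2 (2.32); §7 Prop. 7.1] -/
theorem mainTermFormPolar_eq_zero_of_null (hu : IsH1OnUnitInterval u u') (hf : IsH1OnUnitInterval f f')
    (h0 : mainTermForm u u' = 0) : mainTermFormPolar u u' f f' = 0 := by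
  have h := norm_sq_mainTermFormPolar_le hu hf
  rw [h0, zero_mul] at h
  have hsq : ‖mainTermFormPolar u u' f f'‖ ^ 2 = 0 := le_antisymm h (sq_nonneg _)
  exact norm_eq_zero.mp (pow_eq_zero_iff two_ne_zero |>.mp hsq)

/-- … and symmetrically `P(f,u) = 0`. [cite: Zhang2022LandauSiegel, §2 (2.32); §7 Prop. 7.1] -/
theorem mainTermFormPolar_eq_zero_of_null_right (hu : IsH1OnUnitInterval u u')
    (hf : IsH1OnUnitInterval f f') (h0 : mainTermForm u u' = 0) : mainTermFormPolar f f' u u' = 0 := by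
  rw [mainTermFormPolar_swap, mainTermFormPolar_eq_zero_of_null hu hf h0, map_zero]

/-- **Perturbing a null vector costs exactly second order**: `𝔅(u + t·f) = ‖t‖²·𝔅(f)` for `𝔅(u) = 0`
(polarisation identity; the linear term `2Re(conj t·P(u,f))` vanishes).  This is ls-ref-1's «kernel lemma»
for the `K₀` calibration table, in exact form. [cite: Zhang2022LandauSiegel, §2 (2.32); §7 Prop. 7.1] -/
theorem mainTermForm_null_add_smul (hu : IsH1OnUnitInterval u u') (hf : IsH1OnUnitInterval f f')
    (h0 : mainTermForm u u' = 0) (t : ℂ) :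
    mainTermForm (fun x => u x + t * f x) (fun x => u' x + t * f' x) = ‖t‖ ^ 2 * mainTermForm f f' := by
  rw [mainTermForm_add_smul hu hf, mainTermFormPolar_eq_zero_of_null hu hf h0, h0, mul_zero,
    Complex.zero_re, mul_zero, zero_add, zero_add]

/-- **Null directions are invisible to `𝔅`**: `𝔅(f + t·u) = 𝔅(f)` for `𝔅(u) = 0`, every `t ∈ ℂ`.
[cite: Zhang2022LandauSiegel, §2 (2.32); §7 Prop. 7.1] -/
theorem mainTermForm_add_smul_null (hu : IsH1OnUnitInterval u u') (hf : IsH1OnUnitInterval f f')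
    (h0 : mainTermForm u u' = 0) (t : ℂ) :
    mainTermForm (fun x => f x + t * u x) (fun x => f' x + t * u' x) = mainTermForm f f' := by
  rw [mainTermForm_add_smul hf hu, mainTermFormPolar_eq_zero_of_null_right hu hf h0, h0, mul_zero,
    Complex.zero_re, mul_zero, add_zero, mul_zero, add_zero]

/-! ## The three `K₀` profiles are null vectors of `𝔅 = F₁` -/

/-- `𝔅(k₁ − k₃) = 0` (`F₁ = 𝔅`, `mainTermFormEll_one`; `F_ℓ(k₁ − k₃) = π(80 − 192ℓ + 176ℓ² − 64ℓ³)` at `ℓ = 1`).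
[cite: Zhang2022LandauSiegel, §2 (2.13), (2.23)–(2.25), (2.32)] -/
theorem mainTermForm_k13 : mainTermForm (twoComb 1 3 1 (-1)) (twoComb' 1 3 1 (-1)) = 0 := by
  rw [← mainTermFormEll_one, mainTermFormEll_k13]; ring

/-- `𝔅(k₁ + k₂) = 0`. [cite: Zhang2022LandauSiegel, §2 (2.13), (2.23)–(2.25), (2.32)] -/
theorem mainTermForm_k12 : mainTermForm (twoComb 1 2 1 1) (twoComb' 1 2 1 1) = 0 := by
  rw [← mainTermFormEll_one, mainTermFormEll_k12]; ring

/-- `𝔅(k₂ + k₃) = 0`. [cite: Zhang2022LandauSiegel, §2 (2.13), (2.23)–(2.25), (2.32)] -/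
theorem mainTermForm_k23 : mainTermForm (twoComb 2 3 1 1) (twoComb' 2 3 1 1) = 0 := by
  rw [← mainTermFormEll_one, mainTermFormEll_k23]; ring

/-- `P(k₁ − k₃, f) = 0` for every `H¹` profile `f`. [cite: Zhang2022LandauSiegel, §2 (2.13), (2.32)] -/
theorem mainTermFormPolar_k13 (hf : IsH1OnUnitInterval f f') :
    mainTermFormPolar (twoComb 1 3 1 (-1)) (twoComb' 1 3 1 (-1)) f f' = 0 :=
  mainTermFormPolar_eq_zero_of_null (isC1_twoComb 1 3 1 (-1)).isH1 hf mainTermForm_k13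

/-- `P(k₁ + k₂, f) = 0` for every `H¹` profile `f`. [cite: Zhang2022LandauSiegel, §2 (2.13), (2.32)] -/
theorem mainTermFormPolar_k12 (hf : IsH1OnUnitInterval f f') :
    mainTermFormPolar (twoComb 1 2 1 1) (twoComb' 1 2 1 1) f f' = 0 :=
  mainTermFormPolar_eq_zero_of_null (isC1_twoComb 1 2 1 1).isH1 hf mainTermForm_k12

/-- `P(k₂ + k₃, f) = 0` for every `H¹` profile `f`. [cite: Zhang2022LandauSiegel, §2 (2.13), (2.32)] -/
theorem mainTermFormPolar_k23 (hf : IsH1OnUnitInterval f f') :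
    mainTermFormPolar (twoComb 2 3 1 1) (twoComb' 2 3 1 1) f f' = 0 :=
  mainTermFormPolar_eq_zero_of_null (isC1_twoComb 2 3 1 1).isH1 hf mainTermForm_k23

/-- **`𝔅((k₁ − k₃) + t·f) = ‖t‖²·𝔅(f)`** — perturbing the `K₀` vector `k₁ − k₃` by any `H¹` profile costs exactly
second order. [cite: Zhang2022LandauSiegel, §2 (2.13), (2.32); §7 Prop. 7.1] -/
theorem mainTermForm_k13_add_smul (hf : IsH1OnUnitInterval f f') (t : ℂ) :
    mainTermForm (fun x => twoComb 1 3 1 (-1) x + t * f x) (fun x => twoComb' 1 3 1 (-1) x + t * f' x)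
      = ‖t‖ ^ 2 * mainTermForm f f' :=
  mainTermForm_null_add_smul (isC1_twoComb 1 3 1 (-1)).isH1 hf mainTermForm_k13 t

/-- `𝔅((k₁ + k₂) + t·f) = ‖t‖²·𝔅(f)`. [cite: Zhang2022LandauSiegel, §2 (2.13), (2.32); §7 Prop. 7.1] -/
theorem mainTermForm_k12_add_smul (hf : IsH1OnUnitInterval f f') (t : ℂ) :
    mainTermForm (fun x => twoComb 1 2 1 1 x + t * f x) (fun x => twoComb' 1 2 1 1 x + t * f' x)
      = ‖t‖ ^ 2 * mainTermForm f f' :=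
  mainTermForm_null_add_smul (isC1_twoComb 1 2 1 1).isH1 hf mainTermForm_k12 t

/-- `𝔅((k₂ + k₃) + t·f) = ‖t‖²·𝔅(f)`. [cite: Zhang2022LandauSiegel, §2 (2.13), (2.32); §7 Prop. 7.1] -/
theorem mainTermForm_k23_add_smul (hf : IsH1OnUnitInterval f f') (t : ℂ) :
    mainTermForm (fun x => twoComb 2 3 1 1 x + t * f x) (fun x => twoComb' 2 3 1 1 x + t * f' x)
      = ‖t‖ ^ 2 * mainTermForm f f' :=
  mainTermForm_null_add_smul (isC1_twoComb 2 3 1 1).isH1 hf mainTermForm_k23 t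

/-- **`𝔅(f + t·(k₁ − k₃)) = 𝔅(f)`** — the `K₀` direction `k₁ − k₃` is invisible to `𝔅`.
[cite: Zhang2022LandauSiegel, §2 (2.13), (2.32); §7 Prop. 7.1] -/
theorem mainTermForm_add_smul_k13 (hf : IsH1OnUnitInterval f f') (t : ℂ) :
    mainTermForm (fun x => f x + t * twoComb 1 3 1 (-1) x) (fun x => f' x + t * twoComb' 1 3 1 (-1) x)
      = mainTermForm f f' :=
  mainTermForm_add_smul_null (isC1_twoComb 1 3 1 (-1)).isH1 hf mainTermForm_k13 t

/-- `𝔅(f + t·(k₁ + k₂)) = 𝔅(f)`. [cite: Zhang2022LandauSiegel, §2 (2.13), (2.32); §7 Prop. 7.1] -/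
theorem mainTermForm_add_smul_k12 (hf : IsH1OnUnitInterval f f') (t : ℂ) :
    mainTermForm (fun x => f x + t * twoComb 1 2 1 1 x) (fun x => f' x + t * twoComb' 1 2 1 1 x)
      = mainTermForm f f' :=
  mainTermForm_add_smul_null (isC1_twoComb 1 2 1 1).isH1 hf mainTermForm_k12 t

/-- `𝔅(f + t·(k₂ + k₃)) = 𝔅(f)`. [cite: Zhang2022LandauSiegel, §2 (2.13), (2.32); §7 Prop. 7.1] -/
theorem mainTermForm_add_smul_k23 (hf : IsH1OnUnitInterval f f') (t : ℂ) :
    mainTermForm (fun x => f x + t * twoComb 2 3 1 1 x) (fun x => f' x + t * twoComb' 2 3 1 1 x)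
      = mainTermForm f f' :=
  mainTermForm_add_smul_null (isC1_twoComb 2 3 1 1).isH1 hf mainTermForm_k23 t


/-! ## §2 (v2) The `K₀` cubics below `ℓ = 1`: exact values and strict positivity -/

/-- `F_{1−η}(k₁ − k₃) = π(32η − 16η² + 64η³)` (substitute `ℓ = 1 − η` in `mainTermFormEll_k13`).
[cite: Zhang2022LandauSiegel, §2 (2.10), (2.13), (2.23)–(2.25)] -/
theorem mainTermFormEll_k13_one_sub (η : ℝ) :
    mainTermFormEll (1 - η) (twoComb 1 3 1 (-1)) (twoComb' 1 3 1 (-1)) =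
      π * (32 * η - 16 * η ^ 2 + 64 * η ^ 3) := by
  rw [mainTermFormEll_k13]; ring

/-- `F_{1−η}(k₁ + k₂) = π(8η − 40η² + 72η³)`. [cite: Zhang2022LandauSiegel, §2 (2.10), (2.13), (2.23)–(2.25)] -/
theorem mainTermFormEll_k12_one_sub (η : ℝ) :
    mainTermFormEll (1 - η) (twoComb 1 2 1 1) (twoComb' 1 2 1 1) =
      π * (8 * η - 40 * η ^ 2 + 72 * η ^ 3) := by
  rw [mainTermFormEll_k12]; ring

/-- `F_{1−η}(k₂ + k₃) = π(8η + 56η² + 40η³)`. [cite: Zhang2022LandauSiegel, §2 (2.10), (2.13), (2.23)–(2.25)] -/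
theorem mainTermFormEll_k23_one_sub (η : ℝ) :
    mainTermFormEll (1 - η) (twoComb 2 3 1 1) (twoComb' 2 3 1 1) =
      π * (8 * η + 56 * η ^ 2 + 40 * η ^ 3) := by
  rw [mainTermFormEll_k23]; ring

/-- **`F_ℓ(k₁ − k₃) > 0` for every `ℓ < 1`** (`32 − 16η + 64η² > 0`: discriminant `256 − 8192 < 0`).  With
`mainTermFormEll_k13_neg_of_one_lt` (`< 0` for `ℓ > 1`) and `mainTermForm_k13` (`= 0` at `ℓ = 1`): the sign of
`F_ℓ` on `k₁ − k₃` is exactly the sign of `1 − ℓ`. [cite: Zhang2022LandauSiegel, §2 (2.10), (2.13)] -/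
theorem mainTermFormEll_k13_pos_of_lt_one {ℓ : ℝ} (hℓ : ℓ < 1) :
    0 < mainTermFormEll ℓ (twoComb 1 3 1 (-1)) (twoComb' 1 3 1 (-1)) := by
  have h := mainTermFormEll_k13_one_sub (1 - ℓ)
  rw [sub_sub_cancel] at h
  rw [h]
  have hη : 0 < 1 - ℓ := by linarith
  have hq : 0 < 32 - 16 * (1 - ℓ) + 64 * (1 - ℓ) ^ 2 := by nlinarith [sq_nonneg ((1 - ℓ) - 1 / 8)]
  have : 0 < 32 * (1 - ℓ) - 16 * (1 - ℓ) ^ 2 + 64 * (1 - ℓ) ^ 3 := by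
    have e : 32 * (1 - ℓ) - 16 * (1 - ℓ) ^ 2 + 64 * (1 - ℓ) ^ 3 =
        (1 - ℓ) * (32 - 16 * (1 - ℓ) + 64 * (1 - ℓ) ^ 2) := by ring
    rw [e]; exact mul_pos hη hq
  exact mul_pos Real.pi_pos this

/-- **`F_ℓ(k₁ + k₂) > 0` for every `ℓ < 1`** (`8 − 40η + 72η² > 0`: discriminant `1600 − 2304 < 0`).
[cite: Zhang2022LandauSiegel, §2 (2.10), (2.13)] -/
theorem mainTermFormEll_k12_pos_of_lt_one {ℓ : ℝ} (hℓ : ℓ < 1) :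
    0 < mainTermFormEll ℓ (twoComb 1 2 1 1) (twoComb' 1 2 1 1) := by
  have h := mainTermFormEll_k12_one_sub (1 - ℓ)
  rw [sub_sub_cancel] at h
  rw [h]
  have hη : 0 < 1 - ℓ := by linarith
  have hq : 0 < 8 - 40 * (1 - ℓ) + 72 * (1 - ℓ) ^ 2 := by nlinarith [sq_nonneg ((1 - ℓ) - 5 / 18)]
  have : 0 < 8 * (1 - ℓ) - 40 * (1 - ℓ) ^ 2 + 72 * (1 - ℓ) ^ 3 := by
    have e : 8 * (1 - ℓ) - 40 * (1 - ℓ) ^ 2 + 72 * (1 - ℓ) ^ 3 =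
        (1 - ℓ) * (8 - 40 * (1 - ℓ) + 72 * (1 - ℓ) ^ 2) := by ring
    rw [e]; exact mul_pos hη hq
  exact mul_pos Real.pi_pos this

/-- **`F_ℓ(k₂ + k₃) > 0` for every `ℓ < 1`** (all coefficients positive). [cite: Zhang2022LandauSiegel, §2 (2.10), (2.13)] -/
theorem mainTermFormEll_k23_pos_of_lt_one {ℓ : ℝ} (hℓ : ℓ < 1) :
    0 < mainTermFormEll ℓ (twoComb 2 3 1 1) (twoComb' 2 3 1 1) := by
  have h := mainTermFormEll_k23_one_sub (1 - ℓ)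
  rw [sub_sub_cancel] at h
  rw [h]
  have hη : 0 < 1 - ℓ := by linarith
  exact mul_pos Real.pi_pos (by positivity)

end Literature.NumberTheory.LFunctions.Zhang2022

end
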